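/-
Copyright: the b2b-balaban T⁴-continuum CRUX team, row NE7b leaf lineage `t4-ne7b-formalise-leaf-05` (gen 161). Project licence.
-/
import Summits.QuantumFields.BalabanUV.T4Continuum.Spine.NE7b.BlockAverageKernelFloor
import Summits.QuantumFields.BalabanUV.T4Continuum.Spine.NE7b.TransportedHessianEnergyCeiling
import Literature.MathematicalPhysics.QuantumFieldTheory.Balaban1983to89.B5Composition116

/-!
# ONE HARD STEP's SECTION LETTER ON PRINT's TORUS: the critical section `H` of `re Q′_L` for a symmetric form `V` with `0 ≤ V ≤ γ·R′` and floor
# `m` on `ker Q′_L` has `‖H‖ ≤ (1 + 4dγ∕m)·√(L^d)`, and `‖V‖ ≤ 4dγ` — leaf-03's QFM `opNorm_propagator_le` tested against this lineage's BAKF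
# block-constant section (`‖T₀ g‖² = L^d‖g‖²`), leaf-06's THEC `opNorm_le_of_abs_quad_le`, and the crude bound `R g g ≤ 4d‖g‖²` of the unit
# Dirichlet form (row NE7b, node U5c; [folklore]; the one-level half of this lineage's BATN, filed separately so that it lands on built parents)

Cell `pub-balaban`, sub-cell `t4`, spine estimate NE7b (`T4WeightBudget.RelWeightBound`; the cell's OWN estimate — NOT PRINTED in
[Bałaban 1983–89], NOT PROVED).  Crux-route work under `Spine/NE7b/` by a row leaf (`t4-ne7b-formalise-leaf-05` gen 161) under FREEZE (0)'s
crux-prover clause.  NOTHING of Bałaban's is asserted: typed (1.20) `B5Block118.QsOp`, (1.4)∕(1.21) `B5Action121.GradOp`, the relabelling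
`B5Composition116.recast`, the blocks `B5Blocks16.blockOf`, and kernel theorems of BADD ∕ BAKF ∕ QFM ∕ THEC BY NAME.  No `T4Continuum/Support` leaf
typed; no `def`; zero `sorry`.

WHAT IS PROVED ([folklore]; every `d`, `L ≥ 1`, every torus):
* §1 `unitForm_symm`, `unitForm_nonneg`, **`unitForm_quad_le`** (`R g g ≤ 4d·‖g‖²`: bondwise `(a − b)² ≤ 2a² + 2b²` + translation invariance),
  **`opNorm_le_of_sandwich`** (`V` symmetric, `0 ≤ V g g ≤ γ·R g g`, `0 ≤ γ` ⟹ `‖V‖ ≤ 4dγ`), `blockConstant_apply` (BAKF's section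
  `L^d·(re Q′_L)ᵀ` is `g ↦ g ∘ blockOf`), `blockConstant_norm_sq` (`‖T₀ g‖² = L^d·‖g‖²`), `blockConstant_opNorm_le` (`‖T₀‖ ≤ √(L^d)`).
* §2 **`section_opNorm_le`**: `P′` any name of `fine L P` (`e`), `D = re Q′_L : Tor P′ → Tor P` read through `recast e`, `V` on `Tor P′` symmetric
  with `0 ≤ V ≤ γ·R′` and `m`-coercive on `ker D` (`0 < m`), `H` a `V`-critical section of `D` ⟹ `‖H‖ ≤ (1 + 4dγ∕m)·√(L^d)`; toy.

NOT HERE (honest): the tower (this lineage's `…BlockAverageTowerSectionNorm` runs §2 at every level of BATW's tower, level-free); sharp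
constants; sup-norm currencies; anything of Bałaban's.  BY-NAME EFFECT ON THE WALL: NONE.  NE7b NOT PRINTED ∕ NOT PROVED; spine PROVED 0∕9;
rung (B)+1 on a FINITE torus — NOT infinite volume, NOT the mass gap, NOT Clay.  HONEST DEPENDENCY: continuum YM on T⁴ ⇐ BetaPertH ∧ nine spine
estimates (0∕9 proved); BetaPertH ⇐ (D1) ∧ (D4) ∧ CAP+tail; G-an2-4 gates asym, D1 and NE2∕3∕4.
-/

set_option autoImplicit false

namespace Summit.QuantumFields.BalabanUV.T4Continuum.NE7b.BlockAverageSectionNorm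

open Matrix WithLp Finset
open Literature.MathematicalPhysics.QuantumFieldTheory.Balaban1983to89
open B5Prop11Plancherel (Tor fine unitVec)
open B5Action121 (GradOp)
open B5Block118 (QsOp bpt)
open B5Blocks16 (blockOf blockOf_bpt)
open B5AverageCurlStokes (sum_blocks_real)
open B5RealFields (reM reM_apply)
open B5Composition116 (recast recast_apply)
open Summit.QuantumFields.BalabanUV.T4Continuum.ScalarBlockPoincare (QsOp_apply_blockOf)
open Summit.QuantumFields.BalabanUV.T4Continuum.NE7b.QuadraticFibreMinimiser (opNorm_propagator_le)
open Summit.QuantumFields.BalabanUV.T4Continuum.NE7b.TransportedHessianEnergyCeiling (opNorm_le_of_abs_quad_le)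
open Summit.QuantumFields.BalabanUV.T4Continuum.NE7b.BlockAverageDirichletDomination (coarse_form_eq dot_transpose_mul_self)
open Summit.QuantumFields.BalabanUV.T4Continuum.NE7b.BlockAverageKernelFloor (exists_blockConstant_section)

variable {d : ℕ}

/-! ## §1. Crude letters: the unit Dirichlet form, sandwiched forms, the block-constant section -/

section Unit

variable {P : Fin d → ℕ} [hP : ∀ μ, NeZero (P μ)]

/-- The unit Dirichlet form `R` of a torus (`(re ∂₁)ᵀ(re ∂₁)` in coordinates) is symmetric. [folklore] -/
theorem unitForm_symm {R : EuclideanSpace ℝ (Tor P) →L[ℝ] EuclideanSpace ℝ (Tor P) →L[ℝ] ℝ}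
    (hR : ∀ g h, R g h = ofLp g ⬝ᵥ (((reM (GradOp P 1))ᵀ * reM (GradOp P 1)) *ᵥ ofLp h)) (g h : EuclideanSpace ℝ (Tor P)) :
    R g h = R h g := by
  rw [hR, hR, Matrix.dotProduct_mulVec, ← Matrix.mulVec_transpose, Matrix.transpose_mul, Matrix.transpose_transpose, dotProduct_comm]

/-- The unit Dirichlet form is `≥ 0` (a sum of squares). [folklore] -/
theorem unitForm_nonneg {R : EuclideanSpace ℝ (Tor P) →L[ℝ] EuclideanSpace ℝ (Tor P) →L[ℝ] ℝ}
    (hR : ∀ g h, R g h = ofLp g ⬝ᵥ (((reM (GradOp P 1))ᵀ * reM (GradOp P 1)) *ᵥ ofLp h)) (g : EuclideanSpace ℝ (Tor P)) :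
    0 ≤ R g g := by
  rw [hR, dot_transpose_mul_self]
  exact Finset.sum_nonneg fun i _ => sq_nonneg _

end Unit

/-! ## §1. Three crude letters: the unit Dirichlet form, sandwiched forms, the block-constant section -/

section Crude

variable {P : Fin d → ℕ} [hP : ∀ μ, NeZero (P μ)]

/-- **`R g g ≤ 4d·‖g‖²`**: the unit Dirichlet form is bounded by `4d` (each bond `(g(y+e) − g(y))² ≤ 2g(y+e)² + 2g(y)²`, translation
invariance of `Σ_y`). [folklore] -/
theorem unitForm_quad_le {R : EuclideanSpace ℝ (Tor P) →L[ℝ] EuclideanSpace ℝ (Tor P) →L[ℝ] ℝ}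
    (hR : ∀ g h, R g h = ofLp g ⬝ᵥ (((reM (GradOp P 1))ᵀ * reM (GradOp P 1)) *ᵥ ofLp h)) (g : EuclideanSpace ℝ (Tor P)) :
    R g g ≤ 4 * d * ‖g‖ ^ 2 := by
  have hn2 : ‖g‖ ^ 2 = ∑ y, ofLp g y ^ 2 := by
    rw [EuclideanSpace.norm_sq_eq]
    exact Finset.sum_congr rfl fun y _ => by rw [Real.norm_eq_abs, sq_abs]
  rw [hR, coarse_form_eq, hn2]
  have hshift : ∀ μ : Fin d, ∑ y, ofLp g (y + unitVec P μ) ^ 2 = ∑ y, ofLp g y ^ 2 := fun μ =>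
    Fintype.sum_equiv (Equiv.addRight (unitVec P μ)) _ _ fun _ => rfl
  calc ∑ y, ∑ μ, (ofLp g (y + unitVec P μ) - ofLp g y) ^ 2
      ≤ ∑ y, ∑ μ, (2 * ofLp g (y + unitVec P μ) ^ 2 + 2 * ofLp g y ^ 2) :=
        Finset.sum_le_sum fun y _ => Finset.sum_le_sum fun μ _ => by
          nlinarith [sq_nonneg (ofLp g (y + unitVec P μ) + ofLp g y)]
    _ = ∑ μ : Fin d, (2 * ∑ y, ofLp g (y + unitVec P μ) ^ 2 + 2 * ∑ y, ofLp g y ^ 2) := by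
        rw [Finset.sum_comm]
        refine Finset.sum_congr rfl fun μ _ => ?_
        rw [Finset.sum_add_distrib, Finset.mul_sum, Finset.mul_sum]
    _ = 4 * d * ∑ y, ofLp g y ^ 2 := by
        simp only [hshift, Finset.sum_const, Finset.card_univ, Fintype.card_fin]
        ring

/-- **`‖V‖ ≤ 4dγ`** for a symmetric form with `0 ≤ V g g ≤ γ·R g g` (`0 ≤ γ`): THEC `opNorm_le_of_abs_quad_le` with `unitForm_quad_le`. [folklore] -/
theorem opNorm_le_of_sandwich {R V : EuclideanSpace ℝ (Tor P) →L[ℝ] EuclideanSpace ℝ (Tor P) →L[ℝ] ℝ}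
    (hR : ∀ g h, R g h = ofLp g ⬝ᵥ (((reM (GradOp P 1))ᵀ * reM (GradOp P 1)) *ᵥ ofLp h))
    (hVsymm : ∀ g h, V g h = V h g) (hVpos : ∀ g, 0 ≤ V g g) {γ : ℝ} (hγ : 0 ≤ γ) (hVR : ∀ g, V g g ≤ γ * R g g) :
    ‖V‖ ≤ 4 * d * γ := by
  refine opNorm_le_of_abs_quad_le V hVsymm (by positivity) fun g => ?_
  rw [abs_of_nonneg (hVpos g)]
  calc V g g ≤ γ * R g g := hVR g
    _ ≤ γ * (4 * d * ‖g‖ ^ 2) := mul_le_mul_of_nonneg_left (unitForm_quad_le hR g) hγ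
    _ = 4 * d * γ * ‖g‖ ^ 2 := by ring

variable (L : ℕ) [NeZero L] (P)

/-- The BAKF block-constant section is `g ↦ g ∘ blockOf`: `((L^d·(re Q′_L)ᵀ) v)(x) = v(blockOf x)`. [folklore] -/
theorem blockConstant_apply (v : Tor P → ℝ) (x : Tor (fine L P)) :
    ((((L : ℝ) ^ d) • (reM (QsOp L P))ᵀ) *ᵥ v) x = v (blockOf L P x) := by
  classical
  have hL : ((L : ℂ) ^ d) ≠ 0 := pow_ne_zero _ (by exact_mod_cast NeZero.ne L)
  rw [Matrix.smul_mulVec, Pi.smul_apply, smul_eq_mul, Matrix.mulVec, dotProduct]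
  simp only [Matrix.transpose_apply, reM_apply, QsOp_apply_blockOf]
  rw [Finset.sum_eq_single (blockOf L P x) (fun y _ hy => by rw [if_neg (Ne.symm hy), Complex.zero_re, zero_mul])
    (fun h => absurd (Finset.mem_univ _) h), if_pos rfl]
  have hre : ((1 : ℂ) / (L : ℂ) ^ d).re = 1 / (L : ℝ) ^ d := by
    rw [show (1 : ℂ) / (L : ℂ) ^ d = (((1 : ℝ) / (L : ℝ) ^ d : ℝ) : ℂ) by push_cast; ring, Complex.ofReal_re]
  rw [hre]
  have hL' : (L : ℝ) ^ d ≠ 0 := pow_ne_zero _ (by exact_mod_cast NeZero.ne L)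
  field_simp

/-- **`‖T₀ g‖² = L^d·‖g‖²`** for the block-constant section (each value of `g` is repeated on the `L^d` sites of its block —
`B5AverageCurlStokes.sum_blocks_real`, `B5Blocks16.blockOf_bpt`). [folklore] -/
theorem blockConstant_norm_sq {T : EuclideanSpace ℝ (Tor P) →L[ℝ] EuclideanSpace ℝ (Tor (fine L P))}
    (hT : ∀ g, ofLp (T g) = (((L : ℝ) ^ d) • (reM (QsOp L P))ᵀ) *ᵥ ofLp g) (g : EuclideanSpace ℝ (Tor P)) :
    ‖T g‖ ^ 2 = (L : ℝ) ^ d * ‖g‖ ^ 2 := by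
  have hn2 : ∀ {Q : Fin d → ℕ} [∀ μ, NeZero (Q μ)] (f : EuclideanSpace ℝ (Tor Q)), ‖f‖ ^ 2 = ∑ y, ofLp f y ^ 2 := fun f => by
    rw [EuclideanSpace.norm_sq_eq]
    exact Finset.sum_congr rfl fun y _ => by rw [Real.norm_eq_abs, sq_abs]
  rw [hn2, hn2, hT]
  simp only [blockConstant_apply]
  rw [sum_blocks_real]
  simp only [blockOf_bpt, Finset.sum_const, Finset.card_univ, Finset.mul_sum]
  refine Finset.sum_congr rfl fun y _ => ?_
  rw [Fintype.card_pi, Finset.prod_const, Fintype.card_fin, Finset.card_univ, Fintype.card_fin]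
  ring

/-- **`‖T₀‖ ≤ √(L^d)`**. [folklore] -/
theorem blockConstant_opNorm_le {T : EuclideanSpace ℝ (Tor P) →L[ℝ] EuclideanSpace ℝ (Tor (fine L P))}
    (hT : ∀ g, ofLp (T g) = (((L : ℝ) ^ d) • (reM (QsOp L P))ᵀ) *ᵥ ofLp g) : ‖T‖ ≤ Real.sqrt ((L : ℝ) ^ d) := by
  refine ContinuousLinearMap.opNorm_le_bound _ (Real.sqrt_nonneg _) fun g => ?_
  have h := blockConstant_norm_sq P L hT g
  have h2 : ‖T g‖ ^ 2 = (Real.sqrt ((L : ℝ) ^ d) * ‖g‖) ^ 2 := by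
    rw [mul_pow, Real.sq_sqrt (by positivity), h]
  exact le_of_eq ((pow_left_inj₀ (norm_nonneg _) (by positivity) two_ne_zero).mp h2)

end Crude

/-! ## §2. The critical section's operator norm from the floor, the sandwich and the block-constant test section -/

section Section

variable (L : ℕ) [NeZero L] (P P' : Fin d → ℕ) [hP : ∀ μ, NeZero (P μ)] [hP' : ∀ μ, NeZero (P' μ)]

/-- **`‖H‖ ≤ (1 + 4dγ∕m)·√(L^d)`** for THE `V`-critical section `H` of `D = re Q′_L : Tor P′ → Tor P` (`P′` any name of `fine L P`, read through
`recast e`), when `V` on `Tor P′` is symmetric with `0 ≤ V ≤ γ·R′` (`R′` the unit Dirichlet form, `0 ≤ γ`) and `m`-coercive on `ker D` (`0 < m`):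
QFM `opNorm_propagator_le` with the block-constant test section of §1. [folklore] -/
theorem section_opNorm_le (e : fine L P = P')
    {V R' : EuclideanSpace ℝ (Tor P') →L[ℝ] EuclideanSpace ℝ (Tor P') →L[ℝ] ℝ}
    (hR' : ∀ g h, R' g h = ofLp g ⬝ᵥ (((reM (GradOp P' 1))ᵀ * reM (GradOp P' 1)) *ᵥ ofLp h))
    (hVsymm : ∀ g h, V g h = V h g) (hVpos : ∀ g, 0 ≤ V g g) {γ : ℝ} (hγ : 0 ≤ γ) (hVR : ∀ g, V g g ≤ γ * R' g g)
    {D : EuclideanSpace ℝ (Tor P') →L[ℝ] EuclideanSpace ℝ (Tor P)}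
    (hD : ∀ x, ofLp (D x) = reM (QsOp L P) *ᵥ fun z => ofLp x (recast (congrFun e) z))
    {m : ℝ} (hm : 0 < m) (hfl : ∀ κ, D κ = 0 → m * ‖κ‖ ^ 2 ≤ V κ κ)
    {H : EuclideanSpace ℝ (Tor P) →L[ℝ] EuclideanSpace ℝ (Tor P')}
    (hH : ∀ g, D (H g) = g) (hHo : ∀ g κ, D κ = 0 → V (H g) κ = 0) :
    ‖H‖ ≤ (1 + 4 * d * γ / m) * Real.sqrt ((L : ℝ) ^ d) := by
  subst e
  have hrc : ∀ (h : ∀ ν, fine L P ν = fine L P ν) (z : Tor (fine L P)), recast h z = z := fun h z => by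
    funext ν
    simp [recast_apply]
  have hD' : ∀ x, ofLp (D x) = reM (QsOp L P) *ᵥ ofLp x := fun x => by
    rw [hD]
    simp only [hrc]
  obtain ⟨T₀, hT₀c, hT₀⟩ := exists_blockConstant_section L P hD'
  have hV : ‖V‖ ≤ 4 * d * γ := opNorm_le_of_sandwich hR' hVsymm hVpos hγ hVR
  calc ‖H‖ ≤ (1 + ‖V‖ / m) * ‖T₀‖ := opNorm_propagator_le hT₀ hm hfl hH hHo
    _ ≤ (1 + 4 * d * γ / m) * Real.sqrt ((L : ℝ) ^ d) := by
        have h1 : 1 + ‖V‖ / m ≤ 1 + 4 * d * γ / m := by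
          have := div_le_div_of_nonneg_right hV hm.le
          linarith
        have h0 : 0 ≤ 1 + ‖V‖ / m := by positivity
        exact mul_le_mul h1 (blockConstant_opNorm_le P L hT₀c) (norm_nonneg _) (h0.trans h1)

end Section

/-- Toy: at `d = 4`, `L = 2`, `γ = 1`, `m = 1∕2` the letter is `(1 + 16∕(1∕2))·√16 = 132`. -/
example : (1 + 4 * (4 : ℝ) * 1 / (1 / 2)) * 4 = 132 := by norm_num

end Summit.QuantumFields.BalabanUV.T4Continuum.NE7b.BlockAverageSectionNorm
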